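import Mathlib
import HarnessLib
import Summits.MatrixMultiplication.MatrixMultiplication.Theses.OutsiderSandwich
import Summits.MatrixMultiplication.MatrixMultiplication.Theorems.OutsiderSandwichCornerAngle

/-!
# OutsiderSandwich — the CORNER-SLOPE DIAL, core (decomp-mm lens 4 «extremal reduction», gen 31, part 1/2)

Route `route-MatrixMultiplication-OutsiderSandwich`; cut of record UNCHANGED:
`closes (h₁ : LaserTangency) (h₂ : LaserMergeOptimal) (h₃ : SummitIffLaserTangency) : ω(ℂ) = 2`,
`LaserMergeOptimal` (27897) the declared residual.  Theorem-only support for 27897.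

THE DIAL.  Fix a tensor `t` and write `τ_F = log₂ F⟨2,2,2⟩ ∈ [2, ω]`, `y_F = log₂ F(t)` for a universal
spectral point `F` (Strassen 1988).  At a CORNER `(2, a)` (`a ≤ y_F` for all `F`, e.g. `a = log₂ Q̃(t)`)
and a SLOPE `μ ∈ ℝ` put

* `SlopeFloor t a μ` : `∀ F, a + μ (τ_F − 2) ≤ y_F`   — ω-FREE, universal («the shadow of the spectrum
  leaves the corner with slope `≥ μ`»);
* `SlopeCap t a μ`   : `∃ F, τ_F = ω ∧ y_F ≤ a + μ (ω − 2)` — ω-RELATIVE, existential («a top point lies on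
  or under the slope-`μ` line through the corner»).

Proved here, for every `t, a` (all a few lines of real arithmetic on top of the lineage's `two_le_matExp`,
`matExp_le_omega`, `exists_top_point`, `matExp_eq_two_of_summit`):

* `summit_of_floor_of_cap`     — **the dial closes at every pair of slopes `μ' < μ`**:
  `SlopeFloor t a μ → SlopeCap t a μ' → ω = 2` (at the capped top point `μ(ω−2) ≤ μ'(ω−2)`);
* `slopeFloor_anti`, `slopeCap_mono` — the floor STRENGTHENS and the cap WEAKENS as the slope grows;
* `slopeFloor_of_summit`, `slopeCap_of_summit`, `summit_iff_floor_and_cap` — both pieces are NECESSARY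
  (given the slope-`0` floor and one point at height `≤ a`), so each cut is exact:
  `ω = 2 ⟺ SlopeFloor t a μ ∧ SlopeCap t a μ'` for EVERY `μ' < μ`;
* `omega_le_of_slopeFloor`     — cash value: with `y_F ≤ b` always, slope `μ > 0` gives `ω ≤ 2 + (b−a)/μ`;
* `summit_iff_forall_slopeFloor` — the top of the dial is the summit: `ω = 2 ⟺ ∀ μ, SlopeFloor t a μ`;
* `exists_slopeCap`, `slopeCap_of_le_mul` — **the residual family ends in TRUE**: unconditionally
  `∃ μ, SlopeCap t a μ` (every `μ ≥ (b − a)/(ω − 2)` if `ω > 2`; every `μ` if `ω = 2`).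

So along the dial the attacked piece runs from a theorem (small `μ`) to the summit (`μ → ∞`) while the
paired residual runs from a genuine law down to a triviality; WHICH slope separates them is the whole
question, and every intermediate pair is an exact, strictly re-weighted cut.  Part 2
(`OutsiderSandwichSlopeDial`) calibrates the two corners of the route: `(cw₂, log₂3)` — slope `1/3` =
`LaserFloor` (proved), cap `1/3` = `LaserMergeOptimal` (the residual of record), slope `log₂3/2` ⟸ TOP,
slope `> 1/3` ⟹ `LaserTangency`, slope `1` = «`⟨3⟩ ⊠ ⟨2,2,2⟩ ≲ ⟨4⟩ ⊠ cw₂`» with cash value only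
`ω ≤ 4 − log₂3`; and `(C₁, 2)` — slope `1` = the aside leaf `BlockOneIsMM`, cap `1` = `BlockOneMergeOptimal`.

References: Strassen, J. reine angew. Math. 384 (1988) Thm. 2.3–2.4, 3.8 [Strassen1988]; Strassen,
J. reine angew. Math. 413 (1991) §6 [Strassen1991]; Christandl–Vrana–Zuiddam, J. AMS 36 (2023) Prop. 1.6
[ChristandlVranaZuiddam2023]; Coppersmith–Winograd, JSC 9 (1990) §6–7 [CoppersmithWinograd1990];
Wigderson–Zuiddam, *Asymptotic spectra* (lecture notes, 2023) §§4–5 [WigdersonZuiddam2023].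
-/

set_option linter.dupNamespace false

namespace Summit.MatrixMultiplication.MatrixMultiplication.Theorems.OutsiderSandwichSlopeDialCore

open Literature.Computability.AlgebraicComplexity
open Summit.MatrixMultiplication.MatrixMultiplication.Theses.OutsiderSandwich
open Summit.MatrixMultiplication.MatrixMultiplication.Theorems.OutsiderSandwichLaserFloor
  (two_le_matExp)
open Summit.MatrixMultiplication.MatrixMultiplication.Theorems.OutsiderSandwichLaserFloorCut
  (matExp_le_omega)
open Summit.MatrixMultiplication.MatrixMultiplication.Theorems.OutsiderSandwichLaserFloorTop
  (exists_top_point)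
open Summit.MatrixMultiplication.MatrixMultiplication.Theorems.OutsiderSandwichCornerAngle
  (matExp_eq_two_of_summit)

variable {F : SpectralMap ℂ}

/-! ## §1  The dial at a corner `(2, a)` of the pair shadow `(τ_F, log₂ F t)` — generic part -/

/-- **Slope floor** at the corner `(2, a)` with slope `μ`, for a fixed tensor `t`: every universal
spectral point satisfies `a + μ (τ_F − 2) ≤ log₂ F(t)` (`τ_F = log₂ F⟨2,2,2⟩`).  ω-free and universal.
[cite: Strassen1988, Thm. 2.3–2.4] -/
def SlopeFloor {ι κ μ : Type} [Fintype ι] [Fintype κ] [Fintype μ] (t : ι → κ → μ → ℂ)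
    (a s : ℝ) : Prop :=
  ∀ F : SpectralMap ℂ, IsUniversalSpectralPoint ℂ F →
    a + s * (Real.logb 2 (F (matMulTensor ℂ 2 2 2)) - 2) ≤ Real.logb 2 (F t)

/-- **Slope cap** at the corner `(2, a)` with slope `μ`: SOME universal spectral point attaining
`τ_F = ω` has `log₂ F(t) ≤ a + μ (ω − 2)` (a top point on or under the slope-`μ` line through the
corner).  ω-relative and existential — the residual side of the dial. [cite: Strassen1988, Thm. 2.3–2.4] -/
def SlopeCap {ι κ μ : Type} [Fintype ι] [Fintype κ] [Fintype μ] (t : ι → κ → μ → ℂ)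
    (a s : ℝ) : Prop :=
  ∃ F : SpectralMap ℂ, IsUniversalSpectralPoint ℂ F ∧
    Real.logb 2 (F (matMulTensor ℂ 2 2 2)) = omega ℂ ∧ Real.logb 2 (F t) ≤ a + s * (omega ℂ - 2)

section Generic

variable {ι κ μ : Type} [Fintype ι] [Fintype κ] [Fintype μ] {t : ι → κ → μ → ℂ} {a : ℝ}

/-- `2 ≤ ω` on the spectrum side: the top point has `τ = ω ≥ 2`. [cite: Strassen1988, Thm. 2.4] -/
theorem two_le_omega : (2 : ℝ) ≤ omega ℂ := by
  obtain ⟨G, hG, hGω⟩ := exists_top_point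
  rw [← hGω]; exact two_le_matExp hG

/-- **THE DIAL CLOSES.**  For ANY slopes `μ' < μ`: `SlopeFloor t a μ ∧ SlopeCap t a μ' ⟹ ω(ℂ) = 2`
— at the capped top point, `a + μ(ω−2) ≤ log₂F(t) ≤ a + μ'(ω−2)` forces `ω − 2 ≤ 0`.
[cite: Strassen1988, Thm. 2.3–2.4] -/
theorem summit_of_floor_of_cap {s s' : ℝ} (hlt : s' < s) (hfl : SlopeFloor t a s)
    (hcap : SlopeCap t a s') : _root_.MatrixMultiplication := by
  obtain ⟨G, hG, hGω, hGcap⟩ := hcap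
  have h1 := hfl G hG
  rw [hGω] at h1
  have h2 : (s - s') * (omega ℂ - 2) ≤ 0 := by nlinarith [h1, hGcap]
  have h3 : omega ℂ - 2 ≤ 0 := nonpos_of_mul_nonpos_right (by nlinarith [h2]) (sub_pos.2 hlt)
  exact (_root_.MatrixMultiplication_iff).2 (le_antisymm (by linarith) two_le_omega)

/-- The floor is ANTITONE in the slope (uses only `τ_F ≥ 2`). [cite: Strassen1988, Thm. 2.4] -/
theorem slopeFloor_anti {s₁ s₂ : ℝ} (h : s₁ ≤ s₂) (hfl : SlopeFloor t a s₂) : SlopeFloor t a s₁ := by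
  intro G hG
  have h1 := hfl G hG
  have hτ := two_le_matExp hG
  nlinarith [h1, hτ, mul_le_mul_of_nonneg_right h (sub_nonneg.2 hτ)]

/-- The cap is MONOTONE in the slope (uses only `ω ≥ 2`). [cite: Strassen1988, Thm. 2.4] -/
theorem slopeCap_mono {s₁ s₂ : ℝ} (h : s₁ ≤ s₂) (hcap : SlopeCap t a s₁) : SlopeCap t a s₂ := by
  obtain ⟨G, hG, hGω, hGcap⟩ := hcap
  refine ⟨G, hG, hGω, hGcap.trans ?_⟩
  nlinarith [mul_le_mul_of_nonneg_right h (sub_nonneg.2 two_le_omega)]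

/-- **Necessity of every floor.**  Under `ω = 2` all `τ_F = 2`, so the floor at slope `0`
(`a ≤ log₂F(t)` for all `F`, i.e. `a ≤ log₂ Q̃(t)`) gives the floor at EVERY slope.
[cite: Strassen1988, Thm. 2.4] -/
theorem slopeFloor_of_summit (hS : _root_.MatrixMultiplication) (h0 : SlopeFloor t a 0) (s : ℝ) :
    SlopeFloor t a s := by
  intro G hG
  have h1 := h0 G hG
  rw [matExp_eq_two_of_summit hS hG]
  simpa using h1

/-- **Necessity of every cap.**  Under `ω = 2`, any universal point with `log₂F(t) ≤ a` is a top
point under every slope line. [cite: Strassen1988, Thm. 2.4] -/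
theorem slopeCap_of_summit (hS : _root_.MatrixMultiplication)
    (ha : ∃ F : SpectralMap ℂ, IsUniversalSpectralPoint ℂ F ∧ Real.logb 2 (F t) ≤ a) (s : ℝ) :
    SlopeCap t a s := by
  obtain ⟨G, hG, hGa⟩ := ha
  have hω : omega ℂ = 2 := (_root_.MatrixMultiplication_iff).1 hS
  refine ⟨G, hG, by rw [matExp_eq_two_of_summit hS hG, hω], ?_⟩
  rw [hω]; simpa using hGa

/-- **The exact cut, one per pair of slopes.**  Given the two necessity data (the slope-`0` floor
and a point at height `≤ a`), for every `μ' < μ`:  `ω = 2 ⟺ SlopeFloor t a μ ∧ SlopeCap t a μ'`.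
[cite: Strassen1988, Thm. 2.3–2.4] -/
theorem summit_iff_floor_and_cap {s s' : ℝ} (hlt : s' < s) (h0 : SlopeFloor t a 0)
    (ha : ∃ F : SpectralMap ℂ, IsUniversalSpectralPoint ℂ F ∧ Real.logb 2 (F t) ≤ a) :
    _root_.MatrixMultiplication ↔ SlopeFloor t a s ∧ SlopeCap t a s' :=
  ⟨fun hS => ⟨slopeFloor_of_summit hS h0 s, slopeCap_of_summit hS ha s'⟩,
    fun h => summit_of_floor_of_cap hlt h.1 h.2⟩

/-- **Cash value of a floor.**  If `log₂F(t) ≤ b` for every universal `F`, the floor at slope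
`μ > 0` gives `ω ≤ 2 + (b − a)/μ` (evaluate at a top point). [cite: Strassen1988, Thm. 2.4] -/
theorem omega_le_of_slopeFloor {s b : ℝ} (hs : 0 < s) (hfl : SlopeFloor t a s)
    (hb : ∀ F : SpectralMap ℂ, IsUniversalSpectralPoint ℂ F → Real.logb 2 (F t) ≤ b) :
    omega ℂ ≤ 2 + (b - a) / s := by
  obtain ⟨G, hG, hGω⟩ := exists_top_point
  have h1 := hfl G hG
  rw [hGω] at h1
  have h2 := hb G hG
  have : s * (omega ℂ - 2) ≤ b - a := by linarith
  have h3 : omega ℂ - 2 ≤ (b - a) / s := by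
    rw [le_div_iff₀ hs]; linarith
  linarith

/-- **All floors = the summit.**  If `log₂F(t)` is bounded on universal points (always: `F ≤ R(t)`),
then `ω = 2 ⟺ SlopeFloor t a μ` for EVERY `μ` (given the slope-`0` floor): the dial's top end is the
summit itself. [cite: Strassen1988, Thm. 2.3–2.4] -/
theorem summit_of_forall_slopeFloor {b : ℝ}
    (hb : ∀ F : SpectralMap ℂ, IsUniversalSpectralPoint ℂ F → Real.logb 2 (F t) ≤ b)
    (h : ∀ s : ℝ, SlopeFloor t a s) : _root_.MatrixMultiplication := by
  by_contra hS
  have hω : omega ℂ ≠ 2 := fun e => hS ((_root_.MatrixMultiplication_iff).2 e)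
  have hgt : 2 < omega ℂ := lt_of_le_of_ne two_le_omega (Ne.symm hω)
  -- slope large enough that the cash value drops below ω
  set s : ℝ := (b - a) / (omega ℂ - 2) + 1 with hs
  obtain ⟨G, hG, hGω⟩ := exists_top_point
  have h1 := h s G hG
  rw [hGω] at h1
  have h2 := hb G hG
  have h3 : s * (omega ℂ - 2) ≤ b - a := by linarith
  have h4 : s * (omega ℂ - 2) = (b - a) + (omega ℂ - 2) := by
    rw [hs, add_mul, div_mul_cancel₀ _ (sub_pos.2 hgt).ne', one_mul]
  linarith [sub_pos.2 hgt]

/-- `ω = 2 ⟺` every slope floor holds (given boundedness and the slope-`0` floor).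
[cite: Strassen1988, Thm. 2.3–2.4] -/
theorem summit_iff_forall_slopeFloor {b : ℝ}
    (hb : ∀ F : SpectralMap ℂ, IsUniversalSpectralPoint ℂ F → Real.logb 2 (F t) ≤ b)
    (h0 : SlopeFloor t a 0) : _root_.MatrixMultiplication ↔ ∀ s : ℝ, SlopeFloor t a s :=
  ⟨fun hS s => slopeFloor_of_summit hS h0 s, summit_of_forall_slopeFloor hb⟩

/-- **The residual family ends in TRUE.**  Unconditionally `∃ μ, SlopeCap t a μ` as soon as some
universal point has `log₂F(t) ≤ a`: if `ω = 2` that point is a top point; if `ω > 2` the top point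
`G` sits under the line of slope `(log₂G(t) − a)/(ω − 2)`.  (Which slope is the whole question.)
[cite: Strassen1988, Thm. 2.3–2.4] -/
theorem exists_slopeCap
    (ha : ∃ F : SpectralMap ℂ, IsUniversalSpectralPoint ℂ F ∧ Real.logb 2 (F t) ≤ a) :
    ∃ s : ℝ, SlopeCap t a s := by
  by_cases hω : omega ℂ = 2
  · exact ⟨0, slopeCap_of_summit ((_root_.MatrixMultiplication_iff).2 hω) ha 0⟩
  · have hgt : 2 < omega ℂ := lt_of_le_of_ne two_le_omega (Ne.symm hω)
    obtain ⟨G, hG, hGω⟩ := exists_top_point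
    refine ⟨(Real.logb 2 (G t) - a) / (omega ℂ - 2), G, hG, hGω, le_of_eq ?_⟩
    rw [div_mul_cancel₀ _ (sub_pos.2 hgt).ne']; ring

/-- Quantified vanishing: a cap holds at every slope `μ` with `μ (ω − 2) ≥ b − a`, `b` a bound for
`log₂F(t)` (when `ω > 2` this is every `μ ≥ (b − a)/(ω − 2)`). [cite: Strassen1988, Thm. 2.4] -/
theorem slopeCap_of_le_mul {s b : ℝ}
    (hb : ∀ F : SpectralMap ℂ, IsUniversalSpectralPoint ℂ F → Real.logb 2 (F t) ≤ b)
    (hs : b - a ≤ s * (omega ℂ - 2)) : SlopeCap t a s := by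
  obtain ⟨G, hG, hGω⟩ := exists_top_point
  exact ⟨G, hG, hGω, by linarith [hb G hG]⟩

end Generic

end Summit.MatrixMultiplication.MatrixMultiplication.Theorems.OutsiderSandwichSlopeDialCore
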